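import Summits.BirchSwinnertonDyer.Rank1Residual.X11b.BDPRouteShaAn
import Summits.BirchSwinnertonDyer.Rank1Residual.AdditivePotMult.RankZeroTwistHeights
import Summits.BirchSwinnertonDyer.Rank1Residual.AdditivePotMult.QuadraticTorsionValuation
import HarnessLib

/-!
# The Gross–Zagier bookkeeping identity in analytic rank ZERO (the rank living in the Heegner twist): `ord_p #Ш_an(E^{(d_K)}) + ord_p (L(E,1)/Ω_E) + ord_p ∏c(E^{(d_K)}) + 2 ord_p #E(ℚ)_tors = 2 ord_p [E(K):ℤy_K]` (cell `b2b-bsdres`, sub-cell additive-p1, gen 13)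

HONEST FRAMING (cell `b2b-bsdres`, run/shared/lean/b2b/bsd-rank1-residual/, verbatim in every
file): the goal of the cell is to DELETE the COMBINATION-SHAPED residual classes of the
Birch–Swinnerton-Dyer formula for ALL analytic-rank `≤ 1` elliptic curves over `ℚ` — "full BSD
formula for every rank `≤ 1` curve in class `C`" assembled STRICTLY from published theorems — so
that the rank-`≤ 1` remainder becomes exactly the CONSTRUCTION-SHAPED classes, which are TYPED
(missing-input `Prop`s), NOT attempted. This is not "finishing BSD". Sub-cell additive-p1 is a
RESEARCH ROUTE on X3♯(M) / X4(M); labels UNCHANGED; nothing booked.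

THEOREMS ONLY (no definition, no named fact).

## What this file records

multr1-p2's `X11b.exists_shaAn_padicVal_eq_of_heegner` (Jetchev–Skinner–Wan 2017 (eq:gz for K′)
made exact) is the common core of BOTH halves of the Heegner-point route in analytic rank ONE:
`E` of rank one, the Heegner twist `E^{(d_K)}` of rank zero, and
`ord_p #Ш(E)_an + ord_p (L(E^{d_K},1)/Ω) + ord_p ∏c(E) + 2 ord_p #E^{d_K}(ℚ)_tors = 2 ord_p I_K`.
This file proves the TWIN with the ranks swapped — `E` of analytic rank ZERO, the twist `Wd`
(a globally minimal model of `E^{(d_K)}`) of analytic rank ONE, `y_K ∈ E(K)` the Heegner point: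

  `Ш(E/ℚ)`, `Ш(E/K)` finite; `ord_p #Ш(E/K) = ord_p #Ш(E) + ord_p #Ш(Wd)`; `#Ш(Wd)_an = q ∈ ℚ` with
  `ord_p q + ord_p q₀ + ord_p ∏c_ℓ(Wd) + 2 ord_p #E(ℚ)_tors = 2 ord_p [E(K):ℤy_K]`,
  `q₀ = L(E,1)/Ω_E` (a rational datum — Manin–Drinfeld; the records carry it as Cremona's
  `#Ш_an·∏c/#tors²`).

The computation is that of the rank-one file VERBATIM with the roles of the two curves exchanged:
`L'(E/K,1) = L(E,1)·L'(E^{(d_K)},1)` (product rule with `L(E^{(d_K)},1) = 0`), Gross–Zagier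
(`gross_zagier`), the period relation `Ω(E)Ω(E^{(d)}) = n·Ω(E_K)`, `Ω(Wd) = |u|Ω(E^{(d)})`, the
torsion and `Ш` decompositions under quadratic base change at odd `p` (Kriz–Li §3–4 lemmas of the
tree), and — the one new ingredient — the height identity when the rank lives in the twist,
`m·#E(K)_tors²·ĥ_K(y_K) = 2·I_K²·Reg(E^{(d_K)}/ℚ)` (`exists_mul_canonicalHeight_eq_index_sq_mul_regulator_twist`,
this sub-cell's `RankZeroTwistHeights.lean`). Consumers (next file): Kolyvagin's bound in
Matar–Nekovář's irreducible form (`ord_p #Ш(E/K) ≤ 2 ord_p I_K`) then gives, on `p ∤ ∏c`, the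
rank-ZERO upper half `ord_p #Ш(E) ≤ ord_p #Ш(E)_an` from the LOWER half of the rank-one twist —
the class-level statement the RESIDUAL-MAP cell E-ii (X4(M) ∧ ¬Surj, `r = 0`) lacked.

References: [JetchevSkinnerWan2017] §7.4.1 (eq:gz for K′); [GrossZagier1986] V.§2; [CaiShuTian2014]
Thm. 1.1; [KrizLi2019] §§2–4 (shape); [Miller2011LMS] §1.
-/

noncomputable section

open scoped Classical

open WeierstrassCurve NumberField Literature.NumberTheory.EllipticCurves
  Literature.NumberTheory.EllipticCurves.ModularForms
  Literature.NumberTheory.EllipticCurves.Rank1Residual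
  Literature.NumberTheory.EllipticCurves.KrizLi2019
  Literature.NumberTheory.QuadraticFields

namespace Summit.BirchSwinnertonDyer.Rank1Residual.AdditivePotMult

/-- **Product rule for `L'(E/K, 1)` when the TWIST vanishes at `1`**: `L(E^{(d_K)},1) = 0` gives
`L'(E/K,1) = L(E,1) · L'(E^{(d_K)},1)` (twin of Kriz–Li's `lDerivEK_eq_deriv_mul`; modularity
supplies the differentiability). [cite: GrossZagier1986, V.§2 (p. 312)] -/
theorem lDerivEK_eq_mul_deriv (W : WeierstrassCurve ℚ) [W.IsElliptic] (K : Type) [Field K]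
    [NumberField K] (hmod : hasEntireLFunction_rat)
    (h0 : (W.quadraticTwist (NumberField.discr K : ℚ)).entireLFunction 1 = 0) :
    LDerivEK W K =
      W.entireLFunction 1 * deriv (W.quadraticTwist (NumberField.discr K : ℚ)).entireLFunction 1 := by
  have hD : (NumberField.discr K : ℚ) ≠ 0 := by exact_mod_cast NumberField.discr_ne_zero K
  haveI := W.isElliptic_quadraticTwist hD
  have hf : DifferentiableAt ℂ W.entireLFunction 1 :=
    (W.differentiable_entireLFunction (hmod W)).differentiableAt
  have hg : DifferentiableAt ℂ (W.quadraticTwist (NumberField.discr K : ℚ)).entireLFunction 1 :=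
    ((W.quadraticTwist _).differentiable_entireLFunction (hmod _)).differentiableAt
  unfold LDerivEK
  rw [deriv_fun_mul hf hg, h0, mul_zero, zero_add]

/-- **The Gross–Zagier bookkeeping identity in analytic rank ZERO (rank-one Heegner twist), EXACT
at an odd prime `p`.** Data: `W/ℚ` globally minimal of conductor `N` with `ord_{s=1} L(E,s) = 0`;
`K` imaginary quadratic with the Heegner hypothesis for `N`; `P ∈ E(K)` the Heegner point of a
parametrisation datum `Dt` with `p ∤ c(Dt)` (`hc`); `p` odd with `p ∤ #𝓞_K^×` (`hμ`);
`Wd = Cd • W^{(d_K)}` a globally minimal model of the twist with `ord_p u(Cd) = 0` (`hu`) and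
`ord_{s=1} L(Wd,s) = 1` (`hrd`); a rational `q₀` with `L(E,1)/Ω_E = q₀` (`hq0`; a datum — NO claim
on its valuation). PUBLISHED inputs as binders: `hGZ` (Gross–Zagier 1986 / Cai–Shu–Tian 2014),
`hKo` (Kolyvagin 1990 Thm. A, qualitative), `hGZK` (Gross–Zagier–Kolyvagin over `ℚ`, bsd.S17),
`hmod` (modularity). CONCLUSION: `Ш(E/ℚ)` and `Ш(E/K)` are finite;
`ord_p #Ш(E/K) = ord_p #Ш(E/ℚ) + ord_p #Ш(Wd/ℚ)`; and `#Ш(Wd)_an = q ∈ ℚ` with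
`ord_p q + ord_p q₀ + ord_p ∏_ℓ c_ℓ(Wd) + 2·ord_p #E(ℚ)_tors = 2·ord_p [E(K):ℤP]`
(`q = 8 I² t_d² / (n m t_K² c² w² q₀ |u| c_d)`, `I = [E(K):ℤP]`, `n = [E(ℝ):E(ℝ)⁰]`, `m ∈ {1,4}`,
`w = #𝓞_K^×`, `ord_p t_K = ord_p t_W + ord_p t_d`). Twin of multr1-p2's rank-one identity
`X11b.exists_shaAn_padicVal_eq_of_heegner`, whose computation it repeats with the two curves
exchanged; the height step is `exists_mul_canonicalHeight_eq_index_sq_mul_regulator_twist`.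
[cite: JetchevSkinnerWan2017, §7.4.1 (eq:gz for K′) and §7.3.1 (eq:tamK), pp. 29–30]
[cite: GrossZagier1986, V.§2 (pp. 310–312)] [cite: Miller2011LMS, §1 and Def. 1.1] -/
theorem exists_shaAn_padicVal_eq_of_heegner_rankZero
    (W : WeierstrassCurve ℚ) [W.IsElliptic] [W.IsGloballyMinimal] (p : ℕ) [Fact p.Prime]
    (N : ℕ) [NeZero N] (K : Type) [Field K] [NumberField K]
    (Dt : ModularParametrizationData W N) (H : HeegnerDatum N (NumberField.discr K)) (ι : K →+* ℂ)
    (P : (W.baseChange K).toAffine.Point)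
    -- the published inputs (named facts of the tree)
    (hGZ : gross_zagier N W K) (hKo : kolyvagin N W K)
    (hGZK : rank_eq_analyticRank_of_analyticRank_le_one) (hmod : hasEntireLFunction_rat)
    -- the data
    (hK : IsImaginaryQuadratic K) (hHN : SatisfiesHeegnerHypothesis N K)
    (hP : WeierstrassCurve.Affine.Point.map ι.toRatAlgHom P = heegnerPointComplex Dt H)
    (hp2 : p ≠ 2) (hc : ¬ (p : ℤ) ∣ Dt.c) (hμ : ¬ p ∣ Units.torsionOrder K)
    (hr : W.analyticRank = 0)
    -- a globally minimal model of the quadratic twist by `d_K`, of analytic rank one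
    (Wd : WeierstrassCurve ℚ) [Wd.IsElliptic] [Wd.IsGloballyMinimal] (Cd : VariableChange ℚ)
    (hWd : Cd • W.quadraticTwist (NumberField.discr K : ℚ) = Wd)
    (hu : padicValRat p (Cd.u : ℚ) = 0) (hrd : Wd.analyticRank = 1)
    -- the curve's algebraic central value (a datum)
    (q0 : ℚ) (hq0 : W.entireLFunction 1 / (W.realPeriodRat : ℂ) = (q0 : ℂ)) :
    Finite W.sha ∧ Finite (W.baseChange K).sha ∧
      padicValNat p (W.baseChange K).shaOrder = padicValNat p W.shaOrder + padicValNat p Wd.shaOrder ∧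
      ∃ q : ℚ, shaAn Wd = (q : ℂ) ∧
        padicValRat p q + padicValRat p q0 + padicValNat p Wd.tamagawaProduct +
            2 * padicValNat p W.torsionOrder =
          2 * padicValNat p (AddSubgroup.zmultiples P).index := by
  have hpp : p.Prime := Fact.out
  haveI hEK : (W.baseChange K).IsElliptic := isElliptic_baseChange' W K
  obtain ⟨h2, hKtc⟩ := hK
  haveI : IsTotallyComplex K := hKtc
  have hD0 : (NumberField.discr K : ℚ) ≠ 0 := by exact_mod_cast NumberField.discr_ne_zero K
  haveI hEt : (W.quadraticTwist (NumberField.discr K : ℚ)).IsElliptic :=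
    W.isElliptic_quadraticTwist hD0
  ---------------------------------------------------------------- `L`-values over `ℚ` and `K`
  have hLt' : (W.quadraticTwist (NumberField.discr K : ℚ)).entireLFunction = Wd.entireLFunction := by
    rw [← hWd, entireLFunction_smul]
  have hrt : (W.quadraticTwist (NumberField.discr K : ℚ)).analyticRank = 1 := by
    rw [← hrd, ← hWd, analyticRank_smul]
  have hLt0 : (W.quadraticTwist (NumberField.discr K : ℚ)).entireLFunction 1 = 0 :=
    entireLFunction_one_eq_zero_of_analyticRank_eq_one hrt
  obtain ⟨hleadd, hderivd⟩ := leadingLCoeff_eq_deriv_of_analyticRank_eq_one hrd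
  have hderivt : deriv (W.quadraticTwist (NumberField.discr K : ℚ)).entireLFunction 1 ≠ 0 := by
    rw [hLt']; exact hderivd
  have hLW : W.entireLFunction 1 ≠ 0 := (W.analyticRank_eq_zero_iff_holds (hmod W)).1 hr
  have hprod := lDerivEK_eq_mul_deriv W K hmod hLt0
  have hLK : LDerivEK W K ≠ 0 := by
    rw [hprod]; exact mul_ne_zero hLW hderivt
  ---------------------------------------------------------------- the Heegner point is non-torsion; Kolyvagin
  have hPH : IsHeegnerPoint N W K P := ⟨Dt, H, ι, hP⟩
  have hPinf : ¬ IsOfFinAddOrder P :=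
    (lDerivEK_ne_zero_iff_not_isOfFinAddOrder W N K hGZ ⟨h2, hKtc⟩ hHN hPH).mp hLK
  obtain ⟨hrkK, hShaK⟩ := hKo ⟨h2, hKtc⟩ hHN hPH hPinf
  haveI hfinK : Finite (W.baseChange K).sha := hShaK
  have hShaW : W.ShaFinite := Literature.NumberTheory.EllipticCurves.shaFinite_of_baseChange W K hShaK
  haveI hfinW : Finite W.sha := hShaW
  ---------------------------------------------------------------- Gross–Zagier–Kolyvagin for `W`, `Wd` and the twist model
  have hr1 : W.analyticRank ≤ 1 := by rw [hr]; exact Nat.zero_le _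
  have hrQ : W.mordellWeilRank = 0 := by rw [(hGZK W hr1).1, hr]
  haveI hfinWpt : Finite W.toAffine.Point := W.mordellWeilRank_eq_zero_iff_holds.mp hrQ
  have hrd1 : Wd.analyticRank ≤ 1 := le_of_eq hrd
  obtain ⟨hrankd, hShad⟩ := hGZK Wd hrd1
  have hrkd : Wd.mordellWeilRank = 1 := by rw [hrankd, hrd]
  haveI hfinSd : Finite Wd.sha := hShad
  have hrt1 : (W.quadraticTwist (NumberField.discr K : ℚ)).analyticRank ≤ 1 := le_of_eq hrt
  have hrkt : (W.quadraticTwist (NumberField.discr K : ℚ)).mordellWeilRank = 1 := by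
    rw [(hGZK _ hrt1).1, hrt]
  ---------------------------------------------------------------- a square root of `d_K` in `K`
  obtain ⟨θ, c, hθ, hcθ⟩ := Quadratic.exists_sq_eq_algebraMap (F := ℚ) (K := K) h2
  obtain ⟨qq, hqq, hdq⟩ := NumberField.exists_discr_eq_mul_sq h2 hθ hcθ
  set θ' : K := algebraMap ℚ K qq * θ with hθ'_def
  have hθ' : θ' ∉ Set.range (algebraMap ℚ K) := by
    rintro ⟨r, hr'⟩
    apply hθ
    refine ⟨r / qq, ?_⟩
    have hq' : algebraMap ℚ K qq ≠ 0 := by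
      rw [ne_eq, map_eq_zero]; exact hqq
    rw [map_div₀, hr', hθ'_def, mul_div_cancel_left₀ _ hq']
  have hθ'd : θ' ^ 2 = algebraMap ℚ K (NumberField.discr K : ℚ) := by
    rw [hθ'_def, mul_pow, hcθ, ← map_pow, ← map_mul, hdq, mul_comm]
  ---------------------------------------------------------------- heights and index (the twist carries the rank)
  obtain ⟨m, hm, hheight⟩ :=
    exists_mul_canonicalHeight_eq_index_sq_mul_regulator_twist W K h2 hθ' hθ'd hrkK hrQ hrkt P hPinf
  have hregd : Wd.regulator = (W.quadraticTwist (NumberField.discr K : ℚ)).regulator := by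
    rw [← hWd]; exact regulator_variableChange_holds _ Cd
  rw [← hregd] at hheight
  ---------------------------------------------------------------- Gross–Zagier and the period
  have hLD := (hGZ ⟨h2, hKtc⟩ hHN) Dt H ι P hP
  have hper := two_mul_covolume_div_sqrt_eq_bsdPeriod W K Dt h2
  have hΩ := W.realPeriod_mul_realPeriod_quadraticTwist_eq_mul_bsdPeriod K h2
  have hΩd : Wd.realPeriodRat =
      |((Cd.u : ℚ) : ℝ)| * (W.quadraticTwist (NumberField.discr K : ℚ)).realPeriodRat := by
    rw [← hWd]; exact realPeriodRat_smul_holds (W.quadraticTwist _) Cd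
  ---------------------------------------------------------------- the curve's `L`-value
  have hΩW : 0 < W.realPeriodRat := W.realPeriodRat_pos_holds
  have hΩWC : (W.realPeriodRat : ℂ) ≠ 0 := by exact_mod_cast hΩW.ne'
  have hLWq : W.entireLFunction 1 = (((q0 : ℝ) * W.realPeriodRat : ℝ) : ℂ) := by
    have := (div_eq_iff hΩWC).mp hq0
    rw [this]; push_cast; ring
  have hq00 : q0 ≠ 0 := by
    intro h0
    apply hLW
    rw [hLWq, h0]; simp
  ---------------------------------------------------------------- positivity of everything
  have hΩt : 0 < (W.quadraticTwist (NumberField.discr K : ℚ)).realPeriodRat :=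
    (W.quadraticTwist _).realPeriodRat_pos_holds
  have hΩdpos : 0 < Wd.realPeriodRat := Wd.realPeriodRat_pos_holds
  have hRd : 0 < Wd.regulator := Wd.regulator_pos'
  have hcd : 0 < Wd.tamagawaProduct := Wd.tamagawaProduct_pos_holds
  have htd : 0 < Wd.torsionOrder := Wd.torsionOrder_pos_holds
  have htW : 0 < W.torsionOrder := W.torsionOrder_pos_holds
  have htK : 0 < (W.baseChange K).torsionOrder := (W.baseChange K).torsionOrder_pos_holds
  have hcM : (Dt.c : ℚ) ≠ 0 := by
    have : Dt.c ≠ 0 := by rintro h0; exact hc (h0 ▸ dvd_zero (p : ℤ))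
    exact_mod_cast this
  have hw : 0 < Units.torsionOrder K := Units.torsionOrder_pos K
  have huu : (Cd.u : ℚ) ≠ 0 := Cd.u.ne_zero
  have hm0 : 0 < m := by rcases hm with rfl | rfl <;> exact Nat.succ_pos _
  have hI0 : (AddSubgroup.zmultiples P).index ≠ 0 := by
    intro hI
    rw [hI] at hheight
    have h0 : (m : ℝ) * ((W.baseChange K).torsionOrder : ℝ) ^ 2 * P.canonicalHeight = 0 := by
      rw [hheight]; simp
    have hh0 : P.canonicalHeight = 0 := by
      rcases mul_eq_zero.mp h0 with h' | h'
      · rcases mul_eq_zero.mp h' with h'' | h''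
        · exact absurd (by exact_mod_cast h'' : m = 0) hm0.ne'
        · exact absurd (pow_eq_zero_iff two_ne_zero |>.mp h'') (by exact_mod_cast htK.ne')
      · exact h'
    exact hPinf ((Affine.Point.canonicalHeight_eq_zero_iff_holds P).mp hh0)
  set n := (W.baseChange ℝ).numRealComponents with hn_def
  have hn : n = 1 ∨ n = 2 := numRealComponents_eq_one_or W
  have hn0 : 0 < n := by rcases hn with h' | h' <;> rw [h'] <;> exact Nat.succ_pos _
  ---------------------------------------------------------------- the rational number `q = #Ш(Wd)_an`
  set I := (AddSubgroup.zmultiples P).index with hI_def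
  set q : ℚ := 8 * (I : ℚ) ^ 2 * (Wd.torsionOrder : ℚ) ^ 2 /
      ((n : ℚ) * (m : ℚ) * ((W.baseChange K).torsionOrder : ℚ) ^ 2 * (Dt.c : ℚ) ^ 2 *
        (Units.torsionOrder K : ℚ) ^ 2 * q0 * |(Cd.u : ℚ)| * (Wd.tamagawaProduct : ℚ)) with hq_def
  ---------------------------------------------------------------- real abbreviations
  set ΩW := W.realPeriodRat with hΩW_def
  set Ωt := (W.quadraticTwist (NumberField.discr K : ℚ)).realPeriodRat with hΩt_def
  set B := (W.baseChange K).bsdPeriod with hB_def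
  set R := Wd.regulator with hR_def
  set hh := P.canonicalHeight with hhh_def
  set tK := (W.baseChange K).torsionOrder with htK_def
  set tW := W.torsionOrder with htW_def
  set td := Wd.torsionOrder with htd_def
  set cd := Wd.tamagawaProduct with hcd_def
  set w := Units.torsionOrder K with hw_def
  set cM := Dt.c with hcM_def
  set u := (Cd.u : ℚ) with hu_def
  have hΩW' : ΩW = (W.baseChange ℝ).realPeriod := rfl
  have hΩt' : Ωt = ((W.quadraticTwist (NumberField.discr K : ℚ)).baseChange ℝ).realPeriod := rfl
  rw [← hΩW', ← hΩt'] at hΩ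
  -- `B = ΩW Ωt / n`, `ĥ = 2 I² R / (m tK²)`, the Gross–Zagier constant `= 4 B / (c² w²)`
  have hBeq : B = ΩW * Ωt / n := by
    rw [hΩ]; field_simp
  have hheq : hh = 2 * (I : ℝ) ^ 2 * R / ((m : ℝ) * (tK : ℝ) ^ 2) := by
    rw [← hheight]; field_simp
  have hGZc : 2 * ZLattice.covolume Dt.L.lattice /
        ((cM : ℝ) ^ 2 * ((w : ℝ) / 2) ^ 2 * √|(NumberField.discr K : ℝ)|) =
      4 * B / ((cM : ℝ) ^ 2 * (w : ℝ) ^ 2) := by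
    rw [← hper]; field_simp; ring
  -- the curve's `L`-value as a real number; the twist's derivative
  have hLWne : ((q0 : ℝ) * ΩW : ℝ) ≠ 0 := by
    have hqd' : (q0 : ℝ) ≠ 0 := by exact_mod_cast hq00
    exact mul_ne_zero hqd' hΩW.ne'
  set X : ℝ := (4 * B / ((cM : ℝ) ^ 2 * (w : ℝ) ^ 2) * hh) / ((q0 : ℝ) * ΩW) with hX_def
  have hL1 : deriv Wd.entireLFunction 1 = ((X : ℝ) : ℂ) := by
    have hne : ((((q0 : ℝ) * ΩW : ℝ)) : ℂ) ≠ 0 := by exact_mod_cast hLWne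
    have key : ((((q0 : ℝ) * ΩW : ℝ)) : ℂ) * deriv Wd.entireLFunction 1 =
        ((4 * B / ((cM : ℝ) ^ 2 * (w : ℝ) ^ 2) * hh : ℝ) : ℂ) := by
      rw [← hLWq, ← hLt', ← hprod, hLD, hGZc]
    rw [hX_def, Complex.ofReal_div, ← key, mul_div_cancel_left₀ _ hne]
  have hshaAnR : shaAn Wd = ((X * (td : ℝ) ^ 2 / (|(u : ℝ)| * Ωt * (cd : ℝ) * R) : ℝ) : ℂ) := by
    rw [shaAn_def, hleadd, hL1, hΩd]
    push_cast
    rfl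
  have hXq : X * (td : ℝ) ^ 2 / (|(u : ℝ)| * Ωt * (cd : ℝ) * R) = (q : ℝ) := by
    have hn' : (n : ℝ) ≠ 0 := by exact_mod_cast hn0.ne'
    have hm' : (m : ℝ) ≠ 0 := by exact_mod_cast hm0.ne'
    have htK' : (tK : ℝ) ≠ 0 := by exact_mod_cast htK.ne'
    have htd' : (td : ℝ) ≠ 0 := by exact_mod_cast htd.ne'
    have hcd' : (cd : ℝ) ≠ 0 := by exact_mod_cast hcd.ne'
    have hcM' : (cM : ℝ) ≠ 0 := by
      exact_mod_cast (show cM ≠ 0 by rintro h0; exact hc (h0 ▸ dvd_zero (p : ℤ)))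
    have hw' : (w : ℝ) ≠ 0 := by exact_mod_cast hw.ne'
    have hu' : |(u : ℝ)| ≠ 0 := abs_ne_zero.mpr (by exact_mod_cast huu)
    have hI' : (I : ℝ) ≠ 0 := by exact_mod_cast hI0
    have hqd' : (q0 : ℝ) ≠ 0 := by exact_mod_cast hq00
    have hR' : R ≠ 0 := hRd.ne'
    rw [hX_def, hheq, hBeq, hq_def]
    push_cast
    field_simp
    ring
  have hshaAn : shaAn Wd = (q : ℂ) := by
    rw [hshaAnR, hXq]; norm_cast
  ---------------------------------------------------------------- `p`-adic valuations
  -- torsion: `v_p(tK) = v_p(tW) + v_p(td)` (primary components of the point groups, odd `p`)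
  have htors : padicValNat p tK = padicValNat p tW + padicValNat p td :=
    padicValNat_torsionOrder_baseChange_quadratic_anyRank W K h2 hθ hcθ hqq hdq Wd ⟨Cd, hWd⟩ p hp2
  -- `Ш`: `v_p(S_K) = v_p(S_W) + v_p(S_d)`
  have hsha : padicValNat p (W.baseChange K).shaOrder =
      padicValNat p W.shaOrder + padicValNat p Wd.shaOrder := by
    have hcard := card_primaryComponent_sha_baseChange_quadratic_of_odd_of_finite W K h2 Wd
      ⟨Cd, hWd⟩ (W.baseChange K) ⟨1, one_smul _ _⟩ p hp2
    rw [WeierstrassCurve.shaOrder, WeierstrassCurve.shaOrder, WeierstrassCurve.shaOrder,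
      ← (Nat.pow_right_injective hpp.two_le).eq_iff, pow_add,
      ← natCard_primaryComponent_eq_pow_padicValNat p, ← natCard_primaryComponent_eq_pow_padicValNat p,
      ← natCard_primaryComponent_eq_pow_padicValNat p]
    exact hcard
  -- valuation of `q`
  have hI' : (I : ℚ) ≠ 0 := by exact_mod_cast hI0
  have htd' : (td : ℚ) ≠ 0 := by exact_mod_cast htd.ne'
  have htK' : (tK : ℚ) ≠ 0 := by exact_mod_cast htK.ne'
  have hn' : (n : ℚ) ≠ 0 := by exact_mod_cast hn0.ne'
  have hm' : (m : ℚ) ≠ 0 := by exact_mod_cast hm0.ne'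
  have hcd' : (cd : ℚ) ≠ 0 := by exact_mod_cast hcd.ne'
  have hw' : (w : ℚ) ≠ 0 := by exact_mod_cast hw.ne'
  have hua : |u| ≠ 0 := abs_ne_zero.mpr huu
  have h8 : padicValRat p (8 : ℚ) = 0 := by
    rw [show (8 : ℚ) = ((8 : ℕ) : ℚ) by norm_num, padicValRat.of_nat]
    have : ¬ p ∣ 8 := by
      intro h
      have h' : p ∣ 2 ^ 3 := by simpa using h
      exact hp2 ((Nat.prime_dvd_prime_iff_eq hpp Nat.prime_two).mp (hpp.dvd_of_dvd_pow h'))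
    simp [padicValNat.eq_zero_of_not_dvd this]
  have hvn : padicValRat p (n : ℚ) = 0 := by
    rw [padicValRat.of_nat]
    have : ¬ p ∣ n := by
      rcases hn with h' | h'
      · rw [h']; exact hpp.one_lt.ne' ∘ Nat.dvd_one.mp
      · rw [h']; intro hd; exact hp2 ((Nat.prime_dvd_prime_iff_eq hpp Nat.prime_two).mp hd)
    simp [padicValNat.eq_zero_of_not_dvd this]
  have hvm : padicValRat p (m : ℚ) = 0 := by
    rw [padicValRat.of_nat]
    have : ¬ p ∣ m := by
      rcases hm with rfl | rfl
      · exact hpp.one_lt.ne' ∘ Nat.dvd_one.mp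
      · intro hd
        have h' : p ∣ 2 ^ 2 := by simpa using hd
        exact hp2 ((Nat.prime_dvd_prime_iff_eq hpp Nat.prime_two).mp (hpp.dvd_of_dvd_pow h'))
    simp [padicValNat.eq_zero_of_not_dvd this]
  have hvc : padicValRat p (cM : ℚ) = 0 := by
    rw [padicValRat.of_int, padicValInt.eq_zero_of_not_dvd hc]; rfl
  have hvw : padicValRat p (w : ℚ) = 0 := by
    rw [padicValRat.of_nat, padicValNat.eq_zero_of_not_dvd hμ]; rfl
  have hvu : padicValRat p |u| = 0 := by
    rcases abs_choice u with h' | h'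
    · rw [h']; exact hu
    · rw [h', padicValRat.neg]; exact hu
  have hval : padicValRat p q + padicValRat p q0 + padicValNat p cd +
      2 * padicValNat p tW = 2 * padicValNat p I := by
    have hA1 : (8 : ℚ) * (I : ℚ) ^ 2 ≠ 0 := mul_ne_zero (by norm_num) (pow_ne_zero _ hI')
    have hA2 : (8 : ℚ) * (I : ℚ) ^ 2 * (td : ℚ) ^ 2 ≠ 0 := mul_ne_zero hA1 (pow_ne_zero _ htd')
    have hD1 : (n : ℚ) * (m : ℚ) ≠ 0 := mul_ne_zero hn' hm'
    have hD2 : (n : ℚ) * (m : ℚ) * (tK : ℚ) ^ 2 ≠ 0 := mul_ne_zero hD1 (pow_ne_zero _ htK')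
    have hD3 : (n : ℚ) * (m : ℚ) * (tK : ℚ) ^ 2 * (cM : ℚ) ^ 2 ≠ 0 :=
      mul_ne_zero hD2 (pow_ne_zero _ hcM)
    have hD4 : (n : ℚ) * (m : ℚ) * (tK : ℚ) ^ 2 * (cM : ℚ) ^ 2 * (w : ℚ) ^ 2 ≠ 0 :=
      mul_ne_zero hD3 (pow_ne_zero _ hw')
    have hD5 : (n : ℚ) * (m : ℚ) * (tK : ℚ) ^ 2 * (cM : ℚ) ^ 2 * (w : ℚ) ^ 2 * q0 ≠ 0 :=
      mul_ne_zero hD4 hq00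
    have hD6 : (n : ℚ) * (m : ℚ) * (tK : ℚ) ^ 2 * (cM : ℚ) ^ 2 * (w : ℚ) ^ 2 * q0 * |u| ≠ 0 :=
      mul_ne_zero hD5 hua
    have hD7 : (n : ℚ) * (m : ℚ) * (tK : ℚ) ^ 2 * (cM : ℚ) ^ 2 * (w : ℚ) ^ 2 * q0 * |u| *
        (cd : ℚ) ≠ 0 := mul_ne_zero hD6 hcd'
    have hnum : padicValRat p ((8 : ℚ) * (I : ℚ) ^ 2 * (td : ℚ) ^ 2) =
        2 * padicValNat p I + 2 * padicValNat p td := by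
      rw [padicValRat.mul hA1 (pow_ne_zero _ htd'), padicValRat.mul (by norm_num) (pow_ne_zero _ hI'),
        padicValRat.pow, padicValRat.pow, h8, padicValRat.of_nat, padicValRat.of_nat]
      push_cast; ring
    have hden : padicValRat p ((n : ℚ) * (m : ℚ) * (tK : ℚ) ^ 2 * (cM : ℚ) ^ 2 * (w : ℚ) ^ 2 *
        q0 * |u| * (cd : ℚ)) =
        2 * padicValNat p tK + padicValRat p q0 + padicValNat p cd := by
      rw [padicValRat.mul hD6 hcd', padicValRat.mul hD5 hua, padicValRat.mul hD4 hq00,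
        padicValRat.mul hD3 (pow_ne_zero _ hw'), padicValRat.mul hD2 (pow_ne_zero _ hcM),
        padicValRat.mul hD1 (pow_ne_zero _ htK'), padicValRat.mul hn' hm', padicValRat.pow,
        padicValRat.pow, padicValRat.pow, hvn, hvm, hvc, hvw, hvu, padicValRat.of_nat,
        padicValRat.of_nat]
      push_cast; ring
    rw [hq_def, padicValRat.div hA2 hD7, hnum, hden]
    have e2 : (padicValNat p tK : ℤ) = padicValNat p tW + padicValNat p td := by exact_mod_cast htors
    push_cast
    linarith
  exact ⟨hfinW, hfinK, hsha, q, hshaAn, hval⟩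

end Summit.BirchSwinnertonDyer.Rank1Residual.AdditivePotMult

end
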